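/-
Copyright: the b2b-balaban T⁴-continuum CRUX team, row NE7b leaf lineage `t4-ne7b-formalise-leaf-05` (gen 160). Project licence.
-/
import Summits.QuantumFields.BalabanUV.T4Continuum.Spine.NE7b.BlockAverageCriticalSection
import Summits.QuantumFields.BalabanUV.T4Continuum.Support.ScalarBlockTrialFunction

/-!
# THE UNIFORM CEILING OF THE FREE SCALAR HARD FLOW ON PRINT's TORUS: the effective form of the `η^d`-weighted fine Dirichlet form
# under print's block average `Q′_n` — `(Q.bilinearComp H H) g g`, `H` the critical section of `…BlockAverageCriticalSection` — is
# bounded by `4d·36^d·‖g‖²` for EVERY side `n ≥ 1` (so at every composite level `n = L^k`), every torus and every `g`, through NE2's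
# in-block bump trial function `…Support.ScalarBlockTrialFunction.trial` read as a SECTION of `Q′_n` (`Q′ψ_φ = β₁^d·φ`, `β₁ ≥ 1∕6`,
# `Σ_ν nsq (∂_νψ_φ) ≤ 4d·n^d·nsq φ` BY NAME); with `…BlockAverageKernelFloor`'s floor `2∕L²` the free scalar REFERENCE FLOW's two
# letters `(m_P, C_P) = (2∕L², 4d·36^d)` are level-free tree theorems on print's objects, and `…HardStepMonotone`'s `hcoP` AND `hCP`
# slots are inhabited (row NE7b, node U5c; [folklore] over the tree's kernel theorems BY NAME — HSMO's «the reference flow BY VALUE …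
# ceilings `C_P(k)`» NOT HERE, closed for the scalar torus flow in the `‖·‖²` currency)

Cell `pub-balaban`, sub-cell `t4`, spine estimate NE7b (`T4WeightBudget.RelWeightBound`; the cell's OWN estimate — NOT PRINTED in
[Bałaban 1983–89], NOT PROVED).  Crux-route work under `Spine/NE7b/` by a row leaf (`t4-ne7b-formalise-leaf-05` gen 160) under FREEZE (0)'s
crux-prover clause; the fourth file of this lineage's hard-flow packet (BADD `hRQ` γ = 1 ∕ BAKF `hR` m = 2∕L² ∕ BACS the critical section).
NOTHING of Bałaban's is asserted: the inputs are the tree's KERNEL theorems BY NAME — NE2 leaf-09's `…Support.ScalarBlockTrialFunction`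
(`trial`, `QsOp_trial`, `dirichlet_trial_le`, `beta1_ge`: the bump `b(t) = (t+1)(n−t)∕n²` on print's blocks, typed for row NE2's
variational bound on `Q′G′Q′*`), `…Support.ScalarAveragedPropagator.dirichlet`, BADD (`dot_transpose_mul_self`, `sum_sq_reM_mulVec`), BACS
(`critical_le_transported`, `exists_criticalSection`, `fineForm_symm`, `fineForm_nonneg`, `criticalFlow_nextFloor`), HSMO
(`quad_le_of_dominated_reference`), (37) `…MatrixFormJunction`.  No `T4Continuum/Support` leaf typed (one is READ); no `def`; zero `sorry`.

WHY.  HSMO reads an interacting Hessian `V` against the free reference form `P` and hands the next step `P`'s OWN letters times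
`γ₀ ∕ γ₁`: the floor `m_P` of `P⁺ = P.bilinearComp H H` on the next kernel (`kerCoercive_of_dominates_reference`) and the ceiling `C_P`
with `P⁺ k k ≤ C_P‖k‖²` (`quad_le_of_dominated_reference`), and lists «the reference flow BY VALUE (its floors `m_P(k)` and ceilings
`C_P(k)`)» as NOT HERE.  For the free scalar flow on print's torus BAKF gave `m_P = 2∕L²` at every level and BACS the critical `H`;
the ceiling is the least-energy principle read against ONE good section: any right inverse `T` of `Q′_n` gives `(Q.bilinearComp H H) g g
≤ Q (T g) (T g)` (BACS `critical_le_transported`), and the tree already holds a right inverse with LEVEL-FREE `η`-energy — NE2's bump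
trial function `ψ_φ(n·y + j) = φ(y)·Π_ν b(j_ν)`: `Q′ψ_φ = β₁^d·φ` with `β₁ = (n+1)(n+2)∕(6n²) ≥ 1∕6`, and `Σ_ν nsq (∂_ν^{(n)}ψ_φ) ≤
4d·n^d·nsq φ` because `b` is smooth on the lattice scale inside the blocks (`|n·Δb| ≤ 1`) and small on the faces (`b = 1∕n` there).  So
`T_b g := (β₁^d)⁻¹·ψ_g` is a section of `Q′_n` with `Q (T_b g)(T_b g) = η^d·(β₁^d)⁻²·Σ_ν nsq (∂_νψ_g) ≤ 4d·β₁^{−2d}·‖g‖² ≤ 4d·36^d·‖g‖²`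
— the constant sees neither `n` nor the torus.  (Honest: this is the `‖·‖²` currency HSMO consumes, NOT print's (1.67) right half
`≤ γ₁⟨∂₁g, ∂₁g⟩` against the coarse Dirichlet form, which needs the interpolant-plus-defect competitor of `B5Ineq167UpperZd` — NOT HERE;
and `4d·36^d` is a by-value useless constant, `≈ 2.7·10⁷` at `d = 4`.)

WHAT IS PROVED ([folklore]; `n ≥ 1` via `[NeZero n]`, `M : Fin d → ℕ` with `M μ ≥ 1`, any `d`; `E = EuclideanSpace ℝ (Tor (fine n M))`,
`F = EuclideanSpace ℝ (Tor M)`; `hQ`, `hD` = BADD ∕ BAKF ∕ BACS's coordinate characterisations VERBATIM; the bump section's matrix is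
`bumpSection := of fun x y => if blockOf x = y then (β₁^d)⁻¹·W(digits x) else 0`, written out — no `def`):
* §1 THE BUMP SECTION IN REAL COORDINATES: `bumpMatrix_mulVec` (`(Tm g)(x) = (β₁^d)⁻¹·W(digits x)·g(blockOf x)`), `cplx_bumpMatrix_mulVec`
  (`= (β₁^d)⁻¹ • trial (cplx g)`), **`reM_QsOp_mulVec_bumpMatrix`** (`reM Q′_n (Tm g) = g` — `QsOp_trial` BY NAME), `reM_QsOp_mul_bumpMatrix`
  (`reM Q′_n · Tm = 1`), `dirichlet_smul` (with NE2's `…ScalarAveragedPropagator.nsq_GradOp_mulVec` BY NAME), `beta1_pow_inv_sq_le` (`((β₁^d)⁻¹)² ≤ 36^d`),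
  **`bump_dot_le`** (`(Tm g) ⬝ (A (Tm g)) ≤ 4d·36^d·(g ⬝ g)` — `dirichlet_trial_le` BY NAME).
* §2 THE CLM LETTER: **`exists_bumpSection`** (`∃ T : F →L E`, characterised by `Tm`, with `D (T g) = g` and `Q (T g) (T g) ≤ 4d·36^d·‖g‖²`).
* §3 **THE UNIFORM CEILING OF THE EFFECTIVE FORM**: **`critical_ceiling`** (ANY critical section `H` of `D` for `Q`:
  `(Q.bilinearComp H H) g g ≤ 4d·36^d·‖g‖²` — BACS `critical_le_transported` against §2), `exists_criticalSection_ceiling`.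
* §4 THE REFERENCE FLOW's LETTERS BY VALUE, COMPLETE, on `Tor (fine n (fine L M′))`: **`exists_referenceFlow_letters`** — `∃ H` critical with
  floor `D₂ g = 0 → (2∕L²)‖g‖² ≤ (Q.bilinearComp H H) g g` (BAKF ∕ BACS) AND ceiling `(Q.bilinearComp H H) g g ≤ 4d·36^d·‖g‖²`, every `n`.
* §5 HSMO's `hCP` INHABITED: **`interacting_nextCeiling_of_dominated`** — for ANY symmetric form `V` on `E`, `≥ 0` on `ker D`, with
  `V v v ≤ γ₁·Q v v` (`0 ≤ γ₁`) and `T` the `V`-critical section: `(V.bilinearComp T T) g g ≤ γ₁·(4d·36^d)·‖g‖²`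
  (`…HardStepMonotone.quad_le_of_dominated_reference` with `P := Q`, its section `H :=` the bump section, `hCP :=` §2).
* §5b THE INTERACTING STEP EXISTS: **`exists_interacting_criticalSection`** (`γ₀·Q ≤ V`, `0 < γ₀` ⟹ `V` is `(γ₀·2∕n^d)`-coercive on
  `ker D` ⟹ a `V`-critical section `T` exists — QFM `exists_propagator` with BAKF's `T₀`), **`exists_interacting_nextLetters`** (`V` symmetric,
  `γ₀·Q ≤ V ≤ γ₁·Q`, `0 < γ₀` ⟹ `∃ T` critical with next floor `γ₀·2∕L²` AND next ceiling `γ₁·4d·36^d` — no section hypothesis left).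
* §6 toy: `4d·36^d = 26873856` at `d = 4`; `β₁ = 1` at `n = 1`, `1∕2` at `n = 2`.

NOT HERE (honest): print's (1.67) RIGHT half in its own currency (`≤ γ₁(d)·R g g` against the unit-lattice Dirichlet form; the tree has it
on `ℤ^d` — `B5Ineq167UpperZd` ∕ `…SharpUpperZd` — and for the VECTOR torus operator — `B5Eq166GaussDeltaK.ineq167_DeltaK_sharp`); a good
constant (the bump's `4d·36^d` vs print's `γ₁`); the `ℓ²(ℤ^d)` carrier; covariant `U ≠ 1`; anything of Bałaban's small-field action ((A3) ∕
(A1c), NC-NE7b-α UNRULED).  BY-NAME EFFECT ON THE WALL: NONE (the hard-step cell's reference letters `(m_P, C_P)` inhabited for the free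
scalar flow on print's torus; the wall is (R2)).  NE7b NOT PRINTED ∕ NOT PROVED; spine PROVED 0∕9; rung (B)+1 on a FINITE torus — NOT
infinite volume, NOT the mass gap, NOT Clay.  HONEST DEPENDENCY: continuum YM on T⁴ ⇐ BetaPertH ∧ nine spine estimates (0∕9 proved);
BetaPertH ⇐ (D1) ∧ (D4) ∧ CAP+tail; G-an2-4 gates asym, D1 and NE2∕3∕4.
-/

set_option autoImplicit false

namespace Summit.QuantumFields.BalabanUV.T4Continuum.NE7b.BlockAverageEffectiveCeiling

open Matrix WithLp Finset
open Literature.MathematicalPhysics.QuantumFieldTheory.Balaban1983to89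
open B5Prop11Plancherel (Tor fine)
open B5Prop11Lower (nsq nsq_nonneg)
open B5Action121 (GradOp)
open B5Block118 (QsOp)
open B5Blocks16 (blockOf)
open B5RealFields (IsReal reM cplx isReal_QsOp isReal_GradOp nsq_cplx)
open Summit.QuantumFields.BalabanUV.T4Continuum.ScalarBlockPoincare (nsq_smul)
open Summit.QuantumFields.BalabanUV.T4Continuum.ScalarAveragedPropagator (dirichlet nsq_GradOp_mulVec)
open Summit.QuantumFields.BalabanUV.T4Continuum.ScalarBlockTrialFunction (digits bumpW trial beta1 beta1_ge QsOp_trial dirichlet_trial_le)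
open Summit.QuantumFields.BalabanUV.T4Continuum.NE7b.MatrixFormJunction (exists_map section_transfer)
open Summit.QuantumFields.BalabanUV.T4Continuum.NE7b.HardStepMonotone (quad_le_of_dominated_reference)
open Summit.QuantumFields.BalabanUV.T4Continuum.NE7b.BlockAverageDirichletDomination (dot_transpose_mul_self sum_sq_reM_mulVec)
open Summit.QuantumFields.BalabanUV.T4Continuum.NE7b.BlockAverageCriticalSection
  (exists_criticalSection critical_le_transported fineForm_symm fineForm_nonneg criticalFlow_nextFloor)

variable {d : ℕ} (n : ℕ) [NeZero n] (M : Fin d → ℕ) [hM : ∀ μ, NeZero (M μ)]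

/-! ## §1. The bump section in real coordinates -/

/-- `(Tm g)(x) = (β₁^d)⁻¹·W(digits x)·g(blockOf x)` for the bump section's matrix `Tm = of (x y ↦ if blockOf x = y then (β₁^d)⁻¹·W(digits x) else 0)`.
[folklore] -/
theorem bumpMatrix_mulVec (g : Tor M → ℝ) (x : Tor (fine n M)) :
    ((Matrix.of fun (x : Tor (fine n M)) (y : Tor M) =>
        if blockOf n M x = y then ((beta1 n) ^ d)⁻¹ * bumpW n (digits n M x) else 0) *ᵥ g) x
      = ((beta1 n) ^ d)⁻¹ * bumpW n (digits n M x) * g (blockOf n M x) := by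
  simp only [Matrix.mulVec, dotProduct, Matrix.of_apply, ite_mul, zero_mul, Finset.sum_ite_eq, Finset.mem_univ, if_true]

/-- In complex clothes the bump section is NE2's trial function: `cplx (Tm g) = (β₁^d)⁻¹ • ψ_{cplx g}`. [folklore] -/
theorem cplx_bumpMatrix_mulVec (g : Tor M → ℝ) :
    cplx ((Matrix.of fun (x : Tor (fine n M)) (y : Tor M) =>
        if blockOf n M x = y then ((beta1 n) ^ d)⁻¹ * bumpW n (digits n M x) else 0) *ᵥ g)
      = ((((beta1 n) ^ d)⁻¹ : ℝ) : ℂ) • trial n M (cplx g) := by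
  funext x
  rw [B5RealFields.cplx_apply, bumpMatrix_mulVec, Pi.smul_apply, smul_eq_mul, trial, B5RealFields.cplx_apply]
  push_cast
  ring

/-- **THE BUMP SECTION IS A RIGHT INVERSE OF PRINT's BLOCK AVERAGE**: `reM Q′_n (Tm g) = g` (`…ScalarBlockTrialFunction.QsOp_trial`:
`Q′ψ_φ = β₁^d·φ`, BY NAME). [folklore] -/
theorem reM_QsOp_mulVec_bumpMatrix (g : Tor M → ℝ) :
    reM (QsOp n M) *ᵥ ((Matrix.of fun (x : Tor (fine n M)) (y : Tor M) =>
        if blockOf n M x = y then ((beta1 n) ^ d)⁻¹ * bumpW n (digits n M x) else 0) *ᵥ g) = g := by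
  have hβ : (beta1 n) ^ d ≠ 0 := pow_ne_zero _ (ne_of_gt (beta1_ge n).2)
  have h := (isReal_QsOp n M).cplx_mulVec
    ((Matrix.of fun (x : Tor (fine n M)) (y : Tor M) =>
        if blockOf n M x = y then ((beta1 n) ^ d)⁻¹ * bumpW n (digits n M x) else 0) *ᵥ g)
  rw [cplx_bumpMatrix_mulVec, Matrix.mulVec_smul, QsOp_trial, smul_smul] at h
  have h1 : ((((beta1 n) ^ d)⁻¹ : ℝ) : ℂ) * ((((beta1 n) ^ d : ℝ)) : ℂ) = 1 := by
    rw [← Complex.ofReal_mul, inv_mul_cancel₀ hβ, Complex.ofReal_one]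
  rw [h1, one_smul] at h
  funext y
  have hy := congrFun h y
  simp only [B5RealFields.cplx_apply] at hy
  exact_mod_cast hy

/-- The same as a MATRIX identity `reM Q′_n · Tm = 1` (the `h` of `…MatrixFormJunction.section_transfer`). [folklore] -/
theorem reM_QsOp_mul_bumpMatrix :
    reM (QsOp n M) * (Matrix.of fun (x : Tor (fine n M)) (y : Tor M) =>
        if blockOf n M x = y then ((beta1 n) ^ d)⁻¹ * bumpW n (digits n M x) else 0) = 1 :=
  Matrix.toLin'.injective (LinearMap.ext fun g => by
    rw [Matrix.toLin'_apply, Matrix.toLin'_apply, ← Matrix.mulVec_mulVec, reM_QsOp_mulVec_bumpMatrix, Matrix.one_mulVec])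

/-- `dirichlet` is quadratic: `dirichlet (c • f) = ‖c‖²·dirichlet f`. [folklore] -/
theorem dirichlet_smul (c : ℂ) (f : Tor (fine n M) → ℂ) : dirichlet n M (c • f) = ‖c‖ ^ 2 * dirichlet n M f := by
  unfold dirichlet
  rw [Finset.mul_sum]
  refine Finset.sum_congr rfl fun ν _ => ?_
  rw [Matrix.mulVec_smul, nsq_smul]

omit hM in
/-- `((β₁^d)⁻¹)² ≤ 36^d` from `β₁ ≥ 1∕6`. [folklore] -/
theorem beta1_pow_inv_sq_le : (((beta1 n) ^ d)⁻¹) ^ 2 ≤ (36 : ℝ) ^ d := by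
  have hβ := (beta1_ge n).1
  have hβ0 := (beta1_ge n).2
  have h6 : ((beta1 n) ^ d)⁻¹ ≤ (6 : ℝ) ^ d := by
    rw [← inv_pow]
    exact pow_le_pow_left₀ (by positivity) (by rw [inv_le_comm₀ hβ0 (by norm_num)]; linarith) d
  calc (((beta1 n) ^ d)⁻¹) ^ 2 ≤ ((6 : ℝ) ^ d) ^ 2 := pow_le_pow_left₀ (by positivity) h6 2
    _ = (36 : ℝ) ^ d := by rw [← pow_mul, mul_comm, pow_mul]; norm_num

/-- **THE BUMP SECTION's `η`-ENERGY IS LEVEL-FREE**: `(Tm g) ⬝ (A (Tm g)) ≤ 4d·36^d·(g ⬝ g)` with BADD's fine matrix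
`A = η^d·(reM ∂^η)ᵀ(reM ∂^η)` — `…ScalarBlockTrialFunction.dirichlet_trial_le` (`Σ_ν nsq (∂_νψ_φ) ≤ 4d·n^d·nsq φ`) BY NAME, times
`η^d·(β₁^d)⁻²`. [folklore] -/
theorem bump_dot_le (g : Tor M → ℝ) :
    ((Matrix.of fun (x : Tor (fine n M)) (y : Tor M) =>
        if blockOf n M x = y then ((beta1 n) ^ d)⁻¹ * bumpW n (digits n M x) else 0) *ᵥ g) ⬝ᵥ
      (((1 / (n : ℝ) ^ d) • ((reM (GradOp (fine n M) (n : ℂ)))ᵀ * reM (GradOp (fine n M) (n : ℂ)))) *ᵥ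
        ((Matrix.of fun (x : Tor (fine n M)) (y : Tor M) =>
          if blockOf n M x = y then ((beta1 n) ^ d)⁻¹ * bumpW n (digits n M x) else 0) *ᵥ g))
      ≤ 4 * d * (36 : ℝ) ^ d * (g ⬝ᵥ g) := by
  have hn : (0 : ℝ) < (n : ℝ) ^ d := by
    have : (0 : ℝ) < n := by exact_mod_cast Nat.pos_of_ne_zero (NeZero.ne n)
    positivity
  have hnr : IsReal (GradOp (fine n M) (n : ℂ)) := isReal_GradOp (fine n M) (by simp)
  have hgg : g ⬝ᵥ g = nsq (cplx g) := by rw [nsq_cplx]; simp only [dotProduct, sq]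
  rw [Matrix.smul_mulVec, dotProduct_smul, smul_eq_mul, dot_transpose_mul_self, sum_sq_reM_mulVec hnr,
    cplx_bumpMatrix_mulVec, nsq_GradOp_mulVec, dirichlet_smul, Complex.norm_real, Real.norm_eq_abs, sq_abs, hgg]
  have htr := dirichlet_trial_le n M (cplx g)
  have hsq := beta1_pow_inv_sq_le (d := d) n
  have hD0 : 0 ≤ dirichlet n M (trial n M (cplx g)) := ScalarAveragedPropagator.dirichlet_nonneg n M _
  have hN0 : 0 ≤ nsq (cplx g) := nsq_nonneg _
  calc 1 / (n : ℝ) ^ d * ((((beta1 n) ^ d)⁻¹) ^ 2 * dirichlet n M (trial n M (cplx g)))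
      ≤ 1 / (n : ℝ) ^ d * ((36 : ℝ) ^ d * (4 * d * ((n : ℝ) ^ d * nsq (cplx g)))) := by
        refine mul_le_mul_of_nonneg_left ?_ (by positivity)
        exact mul_le_mul hsq htr hD0 (by positivity)
    _ = 4 * d * (36 : ℝ) ^ d * nsq (cplx g) := by field_simp

/-! ## §2. The CLM letter: a section with a level-free ceiling -/

/-- **THE BUMP SECTION AS A CLM**: for `Q`, `D` characterised by BADD's fine matrix and `reM Q′_n` there is `T : F →L E`, characterised by the
bump matrix, with `D (T g) = g` and `Q (T g) (T g) ≤ 4d·36^d·‖g‖²` for every `g` — a section of print's block average whose `η`-energy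
ceiling sees neither `n` nor the torus. [folklore] -/
theorem exists_bumpSection
    {Q : EuclideanSpace ℝ (Tor (fine n M)) →L[ℝ] EuclideanSpace ℝ (Tor (fine n M)) →L[ℝ] ℝ}
    {D : EuclideanSpace ℝ (Tor (fine n M)) →L[ℝ] EuclideanSpace ℝ (Tor M)}
    (hQ : ∀ x y, Q x y = ofLp x ⬝ᵥ
      (((1 / (n : ℝ) ^ d) • ((reM (GradOp (fine n M) (n : ℂ)))ᵀ * reM (GradOp (fine n M) (n : ℂ)))) *ᵥ ofLp y))
    (hD : ∀ x, ofLp (D x) = reM (QsOp n M) *ᵥ ofLp x) :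
    ∃ T : EuclideanSpace ℝ (Tor M) →L[ℝ] EuclideanSpace ℝ (Tor (fine n M)),
      (∀ g, ofLp (T g) = (Matrix.of fun (x : Tor (fine n M)) (y : Tor M) =>
        if blockOf n M x = y then ((beta1 n) ^ d)⁻¹ * bumpW n (digits n M x) else 0) *ᵥ ofLp g) ∧
      (∀ g, D (T g) = g) ∧ (∀ g, Q (T g) (T g) ≤ 4 * d * (36 : ℝ) ^ d * ‖g‖ ^ 2) := by
  classical
  obtain ⟨T, hT⟩ := exists_map (ι := Tor M) (κ := Tor (fine n M))
    (Matrix.of fun (x : Tor (fine n M)) (y : Tor M) => if blockOf n M x = y then ((beta1 n) ^ d)⁻¹ * bumpW n (digits n M x) else 0)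
  refine ⟨T, hT, section_transfer hD hT (reM_QsOp_mul_bumpMatrix n M), fun g => ?_⟩
  have hn : ‖g‖ ^ 2 = ofLp g ⬝ᵥ ofLp g := by rw [EuclideanSpace.norm_sq_eq]; simp [dotProduct, sq]
  rw [hQ, hT, hn]
  exact bump_dot_le n M (ofLp g)

/-! ## §3. The uniform ceiling of the effective form -/

/-- **THE UNIFORM CEILING OF THE FREE SCALAR HARD FLOW's EFFECTIVE FORM ON PRINT's TORUS.**  For `Q`, `D` characterised in coordinates by BADD's
fine matrix and `reM Q′_n` (ANY `n ≥ 1` — one step or the composite `L^k`), and ANY critical section `H` of `D` for `Q` (`D (H g) = g`,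
`Q (H g)|_{ker D} = 0` — BACS), `(Q.bilinearComp H H) g g ≤ 4d·36^d·‖g‖²` for every coarse field `g`: least energy (BACS `critical_le_transported`)
against the bump section of §2.  The constant is free of `n`, of the torus and of the level. [folklore] -/
theorem critical_ceiling
    {Q : EuclideanSpace ℝ (Tor (fine n M)) →L[ℝ] EuclideanSpace ℝ (Tor (fine n M)) →L[ℝ] ℝ}
    {D : EuclideanSpace ℝ (Tor (fine n M)) →L[ℝ] EuclideanSpace ℝ (Tor M)}
    (hQ : ∀ x y, Q x y = ofLp x ⬝ᵥ
      (((1 / (n : ℝ) ^ d) • ((reM (GradOp (fine n M) (n : ℂ)))ᵀ * reM (GradOp (fine n M) (n : ℂ)))) *ᵥ ofLp y))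
    (hD : ∀ x, ofLp (D x) = reM (QsOp n M) *ᵥ ofLp x)
    {H : EuclideanSpace ℝ (Tor M) →L[ℝ] EuclideanSpace ℝ (Tor (fine n M))}
    (hH : ∀ g, D (H g) = g) (hHo : ∀ g κ, D κ = 0 → Q (H g) κ = 0) (g : EuclideanSpace ℝ (Tor M)) :
    (Q.bilinearComp H H) g g ≤ 4 * d * (36 : ℝ) ^ d * ‖g‖ ^ 2 := by
  obtain ⟨T, -, hT, hTc⟩ := exists_bumpSection n M hQ hD
  calc (Q.bilinearComp H H) g g ≤ (Q.bilinearComp T T) g g := critical_le_transported n M hQ hH hHo hT g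
    _ = Q (T g) (T g) := by rw [ContinuousLinearMap.bilinearComp_apply]
    _ ≤ 4 * d * (36 : ℝ) ^ d * ‖g‖ ^ 2 := hTc g

/-- The critical section EXISTS with the ceiling (BACS `exists_criticalSection` + §3). [folklore] -/
theorem exists_criticalSection_ceiling
    {Q : EuclideanSpace ℝ (Tor (fine n M)) →L[ℝ] EuclideanSpace ℝ (Tor (fine n M)) →L[ℝ] ℝ}
    {D : EuclideanSpace ℝ (Tor (fine n M)) →L[ℝ] EuclideanSpace ℝ (Tor M)}
    (hQ : ∀ x y, Q x y = ofLp x ⬝ᵥ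
      (((1 / (n : ℝ) ^ d) • ((reM (GradOp (fine n M) (n : ℂ)))ᵀ * reM (GradOp (fine n M) (n : ℂ)))) *ᵥ ofLp y))
    (hD : ∀ x, ofLp (D x) = reM (QsOp n M) *ᵥ ofLp x) :
    ∃ H : EuclideanSpace ℝ (Tor M) →L[ℝ] EuclideanSpace ℝ (Tor (fine n M)),
      (∀ g, D (H g) = g) ∧ (∀ g κ, D κ = 0 → Q (H g) κ = 0) ∧
      (∀ g, (Q.bilinearComp H H) g g ≤ 4 * d * (36 : ℝ) ^ d * ‖g‖ ^ 2) := by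
  obtain ⟨H, hH, hHo⟩ := exists_criticalSection n M hQ hD
  exact ⟨H, hH, hHo, critical_ceiling n M hQ hD hH hHo⟩

/-! ## §4. The reference flow's letters by value, complete: floor AND ceiling at every composite level -/

/-- **THE FREE SCALAR REFERENCE FLOW BY VALUE ON PRINT's TORUS — FLOOR AND CEILING, LEVEL-FREE.**  On `E = EuclideanSpace ℝ (Tor (fine n (fine L M′)))`
(ANY `n ≥ 1`: the composite `L^k`), for `Q`, `R`, `D`, `D₂` characterised by BADD's fine matrix, the unit-lattice Dirichlet matrix, `reM Q′_n`, `reM Q′_L`: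
there is a critical section `H` of `D` with `D₂ g = 0 → (2∕L²)‖g‖² ≤ (Q.bilinearComp H H) g g` (BAKF ∕ BACS) and `(Q.bilinearComp H H) g g ≤
4d·36^d·‖g‖²` (§3) — HSMO's `(m_P, C_P) = (2∕L², 4d·36^d)` for the scalar torus flow, both free of `k`, of the volume and (the floor) of `d`. [folklore] -/
theorem exists_referenceFlow_letters (L : ℕ) [NeZero L] (M' : Fin d → ℕ) [∀ μ, NeZero (M' μ)]
    {Q : EuclideanSpace ℝ (Tor (fine n (fine L M'))) →L[ℝ] EuclideanSpace ℝ (Tor (fine n (fine L M'))) →L[ℝ] ℝ}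
    {R : EuclideanSpace ℝ (Tor (fine L M')) →L[ℝ] EuclideanSpace ℝ (Tor (fine L M')) →L[ℝ] ℝ}
    {D : EuclideanSpace ℝ (Tor (fine n (fine L M'))) →L[ℝ] EuclideanSpace ℝ (Tor (fine L M'))}
    {D₂ : EuclideanSpace ℝ (Tor (fine L M')) →L[ℝ] EuclideanSpace ℝ (Tor M')}
    (hQ : ∀ x y, Q x y = ofLp x ⬝ᵥ
      (((1 / (n : ℝ) ^ d) • ((reM (GradOp (fine n (fine L M')) (n : ℂ)))ᵀ * reM (GradOp (fine n (fine L M')) (n : ℂ)))) *ᵥ ofLp y))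
    (hR : ∀ g h, R g h = ofLp g ⬝ᵥ (((reM (GradOp (fine L M') 1))ᵀ * reM (GradOp (fine L M') 1)) *ᵥ ofLp h))
    (hD : ∀ x, ofLp (D x) = reM (QsOp n (fine L M')) *ᵥ ofLp x)
    (hD₂ : ∀ g, ofLp (D₂ g) = reM (QsOp L M') *ᵥ ofLp g) :
    ∃ H : EuclideanSpace ℝ (Tor (fine L M')) →L[ℝ] EuclideanSpace ℝ (Tor (fine n (fine L M'))),
      (∀ g, D (H g) = g) ∧ (∀ g κ, D κ = 0 → Q (H g) κ = 0) ∧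
      (∀ g, D₂ g = 0 → 2 / (L : ℝ) ^ 2 * ‖g‖ ^ 2 ≤ (Q.bilinearComp H H) g g) ∧
      (∀ g, (Q.bilinearComp H H) g g ≤ 4 * d * (36 : ℝ) ^ d * ‖g‖ ^ 2) := by
  obtain ⟨H, hH, hHo⟩ := exists_criticalSection n (fine L M') hQ hD
  exact ⟨H, hH, hHo, criticalFlow_nextFloor n L M' hQ hR hD hH hD₂, critical_ceiling n (fine L M') hQ hD hH hHo⟩

/-! ## §5. HSMO's ceiling letter inhabited: the interacting hard step's next ceiling from one domination letter -/

/-- **THE INTERACTING HARD STEP's NEXT CEILING ON PRINT's TORUS FROM ONE DOMINATION LETTER.**  `Q`, `D` as above; `V` ANY continuous bilinear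
form on `E`, symmetric and `≥ 0` on `ker D`, dominated by the free fine form, `V v v ≤ γ₁·Q v v` for all `v` (`0 ≤ γ₁` — the shape of print's
(1.67)-type upper input at the fine level); `T` the `V`-critical section of `D` (`D (T g) = g`, `V (T g)|_{ker D} = 0`) ⟹
`(V.bilinearComp T T) g g ≤ γ₁·(4d·36^d)·‖g‖²` — `…HardStepMonotone.quad_le_of_dominated_reference` with `P := Q`, the reference section
`H :=` the bump section of §2 (ANY section of `D` serves there) and `hCP :=` §2's ceiling. [folklore] -/
theorem interacting_nextCeiling_of_dominated
    {Q : EuclideanSpace ℝ (Tor (fine n M)) →L[ℝ] EuclideanSpace ℝ (Tor (fine n M)) →L[ℝ] ℝ}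
    {D : EuclideanSpace ℝ (Tor (fine n M)) →L[ℝ] EuclideanSpace ℝ (Tor M)}
    (hQ : ∀ x y, Q x y = ofLp x ⬝ᵥ
      (((1 / (n : ℝ) ^ d) • ((reM (GradOp (fine n M) (n : ℂ)))ᵀ * reM (GradOp (fine n M) (n : ℂ)))) *ᵥ ofLp y))
    (hD : ∀ x, ofLp (D x) = reM (QsOp n M) *ᵥ ofLp x)
    {V : EuclideanSpace ℝ (Tor (fine n M)) →L[ℝ] EuclideanSpace ℝ (Tor (fine n M)) →L[ℝ] ℝ}
    (hVsymm : ∀ u v, V u v = V v u) (hVpos : ∀ κ, D κ = 0 → 0 ≤ V κ κ)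
    {γ₁ : ℝ} (hγ₁ : 0 ≤ γ₁) (hdom : ∀ v, V v v ≤ γ₁ * Q v v)
    {T : EuclideanSpace ℝ (Tor M) →L[ℝ] EuclideanSpace ℝ (Tor (fine n M))}
    (hT : ∀ g, D (T g) = g) (hTorth : ∀ g κ, D κ = 0 → V (T g) κ = 0) (g : EuclideanSpace ℝ (Tor M)) :
    (V.bilinearComp T T) g g ≤ γ₁ * (4 * d * (36 : ℝ) ^ d) * ‖g‖ ^ 2 := by
  obtain ⟨Tb, -, hTb, hTbc⟩ := exists_bumpSection n M hQ hD
  have hCP : ∀ k, (Q.bilinearComp Tb Tb) k k ≤ 4 * d * (36 : ℝ) ^ d * ‖k‖ ^ 2 := fun k => by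
    rw [ContinuousLinearMap.bilinearComp_apply]; exact hTbc k
  exact quad_le_of_dominated_reference V Q D T Tb hT hTb hTorth hVsymm hVpos hγ₁ hdom hCP g

/-- **BOTH HSMO LETTERS AT ONCE for an interacting form sandwiched by the free fine form**: `γ₀·Q ≤ V ≤ γ₁·Q` on `E` (`0 ≤ γ₀`, `0 ≤ γ₁`),
`V` symmetric; on `Tor (fine n (fine L M′))` with `D₂ = Q′_L`: along `V`'s critical section `T`, the next floor `γ₀·(2∕L²)` on `ker D₂`
(BACS `interacting_nextFloor_of_domination`) AND the next ceiling `γ₁·(4d·36^d)` — the interacting hard step inherits the free flow's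
level-free letters times `γ₀ ∕ γ₁`. [folklore] -/
theorem interacting_nextLetters_of_sandwich (L : ℕ) [NeZero L] (M' : Fin d → ℕ) [∀ μ, NeZero (M' μ)]
    {Q : EuclideanSpace ℝ (Tor (fine n (fine L M'))) →L[ℝ] EuclideanSpace ℝ (Tor (fine n (fine L M'))) →L[ℝ] ℝ}
    {R : EuclideanSpace ℝ (Tor (fine L M')) →L[ℝ] EuclideanSpace ℝ (Tor (fine L M')) →L[ℝ] ℝ}
    {D : EuclideanSpace ℝ (Tor (fine n (fine L M'))) →L[ℝ] EuclideanSpace ℝ (Tor (fine L M'))}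
    {D₂ : EuclideanSpace ℝ (Tor (fine L M')) →L[ℝ] EuclideanSpace ℝ (Tor M')}
    (hQ : ∀ x y, Q x y = ofLp x ⬝ᵥ
      (((1 / (n : ℝ) ^ d) • ((reM (GradOp (fine n (fine L M')) (n : ℂ)))ᵀ * reM (GradOp (fine n (fine L M')) (n : ℂ)))) *ᵥ ofLp y))
    (hR : ∀ g h, R g h = ofLp g ⬝ᵥ (((reM (GradOp (fine L M') 1))ᵀ * reM (GradOp (fine L M') 1)) *ᵥ ofLp h))
    (hD : ∀ x, ofLp (D x) = reM (QsOp n (fine L M')) *ᵥ ofLp x)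
    (hD₂ : ∀ g, ofLp (D₂ g) = reM (QsOp L M') *ᵥ ofLp g)
    {V : EuclideanSpace ℝ (Tor (fine n (fine L M'))) →L[ℝ] EuclideanSpace ℝ (Tor (fine n (fine L M'))) →L[ℝ] ℝ}
    (hVsymm : ∀ u v, V u v = V v u) {γ₀ γ₁ : ℝ} (hγ₀ : 0 ≤ γ₀) (hγ₁ : 0 ≤ γ₁)
    (hlo : ∀ v, γ₀ * Q v v ≤ V v v) (hhi : ∀ v, V v v ≤ γ₁ * Q v v)
    {T : EuclideanSpace ℝ (Tor (fine L M')) →L[ℝ] EuclideanSpace ℝ (Tor (fine n (fine L M')))}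
    (hT : ∀ g, D (T g) = g) (hTorth : ∀ g κ, D κ = 0 → V (T g) κ = 0) (g : EuclideanSpace ℝ (Tor (fine L M'))) :
    (D₂ g = 0 → γ₀ * (2 / (L : ℝ) ^ 2) * ‖g‖ ^ 2 ≤ (V.bilinearComp T T) g g) ∧
      (V.bilinearComp T T) g g ≤ γ₁ * (4 * d * (36 : ℝ) ^ d) * ‖g‖ ^ 2 := by
  have hVpos : ∀ κ, D κ = 0 → 0 ≤ V κ κ := fun κ _ =>
    (mul_nonneg hγ₀ (fineForm_nonneg n (fine L M') hQ κ)).trans (hlo κ)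
  exact ⟨BlockAverageCriticalSection.interacting_nextFloor_of_domination n L M' hQ hR hD hD₂ hγ₀ hlo hT g,
    interacting_nextCeiling_of_dominated n (fine L M') hQ hD hVsymm hVpos hγ₁ hhi hT hTorth g⟩

/-! ## §5b. The interacting critical section EXISTS: one domination letter with `γ₀ > 0` makes `V` coercive on `ker Q′_n` -/

/-- **THE INTERACTING HARD STEP EXISTS ON PRINT's TORUS.**  `Q`, `D` characterised by BADD's fine matrix and `reM Q′_n`; `V` ANY continuous
bilinear form on `E` with `γ₀·Q v v ≤ V v v` and `0 < γ₀` ⟹ `V` is `(γ₀·2∕n^d)`-coercive on `ker D` (BACS `fineForm_kerCoercive`), hence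
(`…QuadraticFibreMinimiser.exists_propagator` with BAKF's block-constant section as auxiliary right inverse) there is a `V`-CRITICAL section
`T : F →L E` — `D (T g) = g`, `V (T g) κ = 0` on `ker D`: HSMO's `T` slot inhabited for every interacting form dominating the free one. [folklore] -/
theorem exists_interacting_criticalSection
    {Q : EuclideanSpace ℝ (Tor (fine n M)) →L[ℝ] EuclideanSpace ℝ (Tor (fine n M)) →L[ℝ] ℝ}
    {D : EuclideanSpace ℝ (Tor (fine n M)) →L[ℝ] EuclideanSpace ℝ (Tor M)}
    (hQ : ∀ x y, Q x y = ofLp x ⬝ᵥ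
      (((1 / (n : ℝ) ^ d) • ((reM (GradOp (fine n M) (n : ℂ)))ᵀ * reM (GradOp (fine n M) (n : ℂ)))) *ᵥ ofLp y))
    (hD : ∀ x, ofLp (D x) = reM (QsOp n M) *ᵥ ofLp x)
    {V : EuclideanSpace ℝ (Tor (fine n M)) →L[ℝ] EuclideanSpace ℝ (Tor (fine n M)) →L[ℝ] ℝ}
    {γ₀ : ℝ} (hγ₀ : 0 < γ₀) (hdom : ∀ v, γ₀ * Q v v ≤ V v v) :
    ∃ T : EuclideanSpace ℝ (Tor M) →L[ℝ] EuclideanSpace ℝ (Tor (fine n M)),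
      (∀ g, D (T g) = g) ∧ (∀ g κ, D κ = 0 → V (T g) κ = 0) := by
  obtain ⟨T₀, -, hT₀⟩ := BlockAverageKernelFloor.exists_blockConstant_section n M hD
  have hco : ∀ κ, D κ = 0 → γ₀ * (2 / (n : ℝ) ^ d) * ‖κ‖ ^ 2 ≤ V κ κ := fun κ hκ =>
    calc γ₀ * (2 / (n : ℝ) ^ d) * ‖κ‖ ^ 2 = γ₀ * (2 / (n : ℝ) ^ d * ‖κ‖ ^ 2) := by ring
      _ ≤ γ₀ * Q κ κ := mul_le_mul_of_nonneg_left (BlockAverageCriticalSection.fineForm_kerCoercive n M hQ hD κ hκ) hγ₀.le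
      _ ≤ V κ κ := hdom κ
  obtain ⟨T, hT, hTo, -⟩ := QuadraticFibreMinimiser.exists_propagator (Q := V) hT₀
    (mul_pos hγ₀ (BlockAverageCriticalSection.two_div_pow_pos (d := d) n)) hco
  exact ⟨T, hT, hTo⟩

/-- **THE INTERACTING HARD STEP ON PRINT's TORUS, SELF-CONTAINED**: `V` symmetric with `γ₀·Q ≤ V ≤ γ₁·Q` on `E`, `0 < γ₀` ⟹ THERE IS a
`V`-critical section `T` of `D` and along it the next floor `γ₀·(2∕L²)` on `ker Q′_L` and the next ceiling `γ₁·(4d·36^d)` — no section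
hypothesis left (§5b + `interacting_nextLetters_of_sandwich`). [folklore] -/
theorem exists_interacting_nextLetters (L : ℕ) [NeZero L] (M' : Fin d → ℕ) [∀ μ, NeZero (M' μ)]
    {Q : EuclideanSpace ℝ (Tor (fine n (fine L M'))) →L[ℝ] EuclideanSpace ℝ (Tor (fine n (fine L M'))) →L[ℝ] ℝ}
    {R : EuclideanSpace ℝ (Tor (fine L M')) →L[ℝ] EuclideanSpace ℝ (Tor (fine L M')) →L[ℝ] ℝ}
    {D : EuclideanSpace ℝ (Tor (fine n (fine L M'))) →L[ℝ] EuclideanSpace ℝ (Tor (fine L M'))}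
    {D₂ : EuclideanSpace ℝ (Tor (fine L M')) →L[ℝ] EuclideanSpace ℝ (Tor M')}
    (hQ : ∀ x y, Q x y = ofLp x ⬝ᵥ
      (((1 / (n : ℝ) ^ d) • ((reM (GradOp (fine n (fine L M')) (n : ℂ)))ᵀ * reM (GradOp (fine n (fine L M')) (n : ℂ)))) *ᵥ ofLp y))
    (hR : ∀ g h, R g h = ofLp g ⬝ᵥ (((reM (GradOp (fine L M') 1))ᵀ * reM (GradOp (fine L M') 1)) *ᵥ ofLp h))
    (hD : ∀ x, ofLp (D x) = reM (QsOp n (fine L M')) *ᵥ ofLp x)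
    (hD₂ : ∀ g, ofLp (D₂ g) = reM (QsOp L M') *ᵥ ofLp g)
    {V : EuclideanSpace ℝ (Tor (fine n (fine L M'))) →L[ℝ] EuclideanSpace ℝ (Tor (fine n (fine L M'))) →L[ℝ] ℝ}
    (hVsymm : ∀ u v, V u v = V v u) {γ₀ γ₁ : ℝ} (hγ₀ : 0 < γ₀) (hγ₁ : 0 ≤ γ₁)
    (hlo : ∀ v, γ₀ * Q v v ≤ V v v) (hhi : ∀ v, V v v ≤ γ₁ * Q v v) :
    ∃ T : EuclideanSpace ℝ (Tor (fine L M')) →L[ℝ] EuclideanSpace ℝ (Tor (fine n (fine L M'))),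
      (∀ g, D (T g) = g) ∧ (∀ g κ, D κ = 0 → V (T g) κ = 0) ∧
      (∀ g, D₂ g = 0 → γ₀ * (2 / (L : ℝ) ^ 2) * ‖g‖ ^ 2 ≤ (V.bilinearComp T T) g g) ∧
      (∀ g, (V.bilinearComp T T) g g ≤ γ₁ * (4 * d * (36 : ℝ) ^ d) * ‖g‖ ^ 2) := by
  obtain ⟨T, hT, hTo⟩ := exists_interacting_criticalSection n (fine L M') hQ hD hγ₀ hlo
  exact ⟨T, hT, hTo, fun g => (interacting_nextLetters_of_sandwich n L M' hQ hR hD hD₂ hVsymm hγ₀.le hγ₁ hlo hhi hT hTo g).1,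
    fun g => (interacting_nextLetters_of_sandwich n L M' hQ hR hD hD₂ hVsymm hγ₀.le hγ₁ hlo hhi hT hTo g).2⟩

/-! ## §6. Toy -/

/-- Toy: the level-free ceiling `4d·36^d` is `26873856` at `d = 4`; NE2's bump average `β₁ = (n+1)(n+2)∕(6n²)` is `1` at `n = 1` and
`1∕2` at `n = 2` (and tends to `1∕6`). -/
example : (4 : ℝ) * (4 : ℕ) * 36 ^ 4 = 26873856 ∧ beta1 1 = 1 ∧ beta1 2 = 1 / 2 := by
  refine ⟨by norm_num, ?_, ?_⟩ <;> norm_num [beta1]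

end Summit.QuantumFields.BalabanUV.T4Continuum.NE7b.BlockAverageEffectiveCeiling
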